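import Summits.CriticalPhenomena.PercolationContinuityZ3.Theorems.PercNearOneGluingAdditiveGluingEdgeAffine
import Literature.Probability.LatticeModels.SahiThirdOrderCorrelation
import HarnessLib

/-!
# Sahi's `E₃` along one edge: the Bernstein decomposition and the EDGE-INDUCTION SCHEMA
# ("edgewise Bernstein positivity ⇒ `E₃ ≥ 0` on every finite weighted graph")

Support file (prover prim-l12-p1 gen 3, P1 line; `--supports stmt-CriticalPhenomena-4575`).  No named facts, no sorries, no `native_decide`;
two small bookkeeping definitions (`polar₁`, the polarised Bernstein coefficient, and `fracEdges`, the set of edges with a weight strictly between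
`0` and `1`).

For three events `A, B, C` of bond percolation on `Fin n` and a weight function `w`, write `T(w) = E₃(A,B,C)` under `prodBernoulli w`
(`Literature.Probability.LatticeModels.sahiE3`).  Fix an edge `e` with `p = w e` and let `w⁰ = w[e ↦ 0]`, `w¹ = w[e ↦ 1]`, `μ⁰, μ¹` the two laws.
By the one-bond decomposition `μ_w(S) = (1−p)·μ⁰(S) + p·μ¹(S)` (tree: `stub_oneBondDecomp_k15`, …AdditiveGluingOneBond) the cubic `T` is a
Bernstein cubic in `p`:
  `T(w) = (1−p)³·T(w⁰) + 3p(1−p)²·F(μ⁰,μ⁰,μ¹) + 3p²(1−p)·F(μ⁰,μ¹,μ¹) + p³·T(w¹)`            (`sahiE3_oneBond`)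
with `F` the symmetric trilinear polarisation of `E₃` — written out as `polar₁ μ ν A B C = F(μ,μ,ν)` (so `F(μ,ν,ν) = polar₁ ν μ A B C`).
**Theorem (`sahiE3_nonneg_of_edgeBernstein`).**  If the two mixed coefficients are nonnegative for EVERY weight function and EVERY edge,
`0 ≤ polar₁ μ_{w[e↦0]} μ_{w[e↦1]} A B C` and `0 ≤ polar₁ μ_{w[e↦1]} μ_{w[e↦0]} A B C`, then `0 ≤ E₃(A,B,C)` under `prodBernoulli w` for every `w`.
Proof: induction on the number of edges with `0 < w e < 1`; such an edge is removed by passing to `w⁰, w¹` (induction hypotheses = the two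
extreme Bernstein coefficients), and when no such edge is left `prodBernoulli w` is a point mass (tree: `real_eq_ite_of_zeroOne`) and `E₃` of a point
mass vanishes identically (`sahiE3_eq_zero_of_zeroOne`).  This is the induction underlying the cell's 'terminal-edge step' programme; it reduces each
of the seven open four-point decreasing frontier rows (12, 15, 27, 30, 36, 37, 44 of …FrontierDecRowsLeFive) for ALL `n` to the nonnegativity of its
polarised edge forms, which holds numerically for all edge types (census: run/shared/lean/prim/prim-l12/FROM-prim-l12-p1-g3-FREE-VERTEX-SPLIT.md,
addendum 09:00Z; kit j092195) and is certified exactly (degree-3 cone over proved rows + the induction hypothesis) for every terminal–terminal edge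
type of rows 36 (PATH) and 44 (kit j094120/j094121).  The statement holds for ARBITRARY events `A, B, C` (no monotonicity or pattern structure is
used), so it applies verbatim to increasing rows (γ) as well.
-/

noncomputable section

namespace Summit.CriticalPhenomena.PercolationContinuityZ3.Theorems

namespace EdgeInduction

open MeasureTheory Literature.Probability.Percolation Literature.Probability.LatticeModels
open scoped Classical

variable {n : ℕ}

/-- The polarised Bernstein coefficient `F(μ,μ,ν)` of Sahi's cubic `E₃(A,B,C)` (symmetric trilinear polarisation of
`2m(ABC) + m(A)m(B)m(C) − m(A)m(BC) − m(B)m(AC) − m(C)m(AB)` on probability laws, two slots at `μ`, one at `ν`). [this work] -/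
def polar₁ (μ ν : Measure (BondConfig (Fin n))) (A B C : Set (BondConfig (Fin n))) : ℝ :=
  (1 / 3 : ℝ) * (2 * ν.real (A ∩ B ∩ C) + 4 * μ.real (A ∩ B ∩ C)
    + (ν.real A * μ.real B * μ.real C + μ.real A * ν.real B * μ.real C + μ.real A * μ.real B * ν.real C)
    - (μ.real A * μ.real (B ∩ C) + μ.real B * μ.real (A ∩ C) + μ.real C * μ.real (A ∩ B))
    - (ν.real A * μ.real (B ∩ C) + μ.real A * ν.real (B ∩ C) + ν.real B * μ.real (A ∩ C) + μ.real B * ν.real (A ∩ C)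
        + ν.real C * μ.real (A ∩ B) + μ.real C * ν.real (A ∩ B)))

/-- **`E₃` along one edge is a Bernstein cubic** in the weight `p = w e`, with extreme coefficients `E₃` under `w[e↦0]`, `w[e↦1]` and mixed
coefficients `polar₁`. [this work] -/
theorem sahiE3_oneBond (w : Sym2 (Fin n) → unitInterval) (e : Sym2 (Fin n)) (A B C : Set (BondConfig (Fin n))) :
    sahiE3 (prodBernoulli w) A B C =
      (1 - (w e : ℝ)) ^ 3 * sahiE3 (prodBernoulli (Function.update w e 0)) A B C
      + 3 * (w e : ℝ) * (1 - (w e : ℝ)) ^ 2 * polar₁ (prodBernoulli (Function.update w e 0)) (prodBernoulli (Function.update w e 1)) A B C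
      + 3 * (w e : ℝ) ^ 2 * (1 - (w e : ℝ)) * polar₁ (prodBernoulli (Function.update w e 1)) (prodBernoulli (Function.update w e 0)) A B C
      + (w e : ℝ) ^ 3 * sahiE3 (prodBernoulli (Function.update w e 1)) A B C := by
  simp only [sahiE3, polar₁]
  rw [stub_oneBondDecomp_k15 n w e (A ∩ B ∩ C), stub_oneBondDecomp_k15 n w e A, stub_oneBondDecomp_k15 n w e B,
    stub_oneBondDecomp_k15 n w e C, stub_oneBondDecomp_k15 n w e (B ∩ C), stub_oneBondDecomp_k15 n w e (A ∩ C),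
    stub_oneBondDecomp_k15 n w e (A ∩ B)]
  ring

/-- **Base case**: if every weight is `0` or `1`, `prodBernoulli w` is a point mass and `E₃(A,B,C) = 0` for arbitrary events. [this work] -/
theorem sahiE3_eq_zero_of_zeroOne (w : Sym2 (Fin n) → unitInterval) (hw : ∀ e, w e = 0 ∨ w e = 1)
    (A B C : Set (BondConfig (Fin n))) : sahiE3 (prodBernoulli w) A B C = 0 := by
  simp only [sahiE3]
  rw [real_eq_ite_of_zeroOne w hw (A ∩ B ∩ C), real_eq_ite_of_zeroOne w hw A, real_eq_ite_of_zeroOne w hw B, real_eq_ite_of_zeroOne w hw C,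
    real_eq_ite_of_zeroOne w hw (B ∩ C), real_eq_ite_of_zeroOne w hw (A ∩ C), real_eq_ite_of_zeroOne w hw (A ∩ B)]
  simp only [Set.mem_inter_iff]
  by_cases hA : {e | w e = 1} ∈ A <;> by_cases hB : {e | w e = 1} ∈ B <;> by_cases hC : {e | w e = 1} ∈ C <;> norm_num [hA, hB, hC]

/-- The edges whose weight lies strictly between `0` and `1`. [this work] -/
def fracEdges (w : Sym2 (Fin n) → unitInterval) : Finset (Sym2 (Fin n)) :=
  Finset.univ.filter fun e => (0 : ℝ) < w e ∧ (w e : ℝ) < 1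

/-- A weight outside `fracEdges` is `0` or `1`. [folklore] -/
theorem eq_zero_or_one_of_not_mem_fracEdges {w : Sym2 (Fin n) → unitInterval} {e : Sym2 (Fin n)} (he : e ∉ fracEdges w) :
    w e = 0 ∨ w e = 1 := by
  have h0 : (0 : ℝ) ≤ w e := (w e).2.1
  have h1 : (w e : ℝ) ≤ 1 := (w e).2.2
  simp only [fracEdges, Finset.mem_filter, Finset.mem_univ, true_and, not_and, not_lt] at he
  rcases h0.eq_or_lt with h | h
  · left; exact Subtype.ext h.symm
  · right; exact Subtype.ext (le_antisymm h1 (he h))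

/-- Updating the weight of `e` to `0` or `1` removes `e` from `fracEdges` and changes nothing else. [folklore] -/
theorem fracEdges_update_subset (w : Sym2 (Fin n) → unitInterval) (e : Sym2 (Fin n)) (v : unitInterval) (hv : v = 0 ∨ v = 1) :
    fracEdges (Function.update w e v) ⊆ (fracEdges w).erase e := by
  intro f hf
  simp only [fracEdges, Finset.mem_filter, Finset.mem_univ, true_and] at hf
  rw [Finset.mem_erase]
  by_cases hfe : f = e
  · subst hfe
    rw [Function.update_self] at hf
    rcases hv with rfl | rfl
    · simp at hf
    · simp at hf
  · rw [Function.update_of_ne hfe] at hf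
    exact ⟨hfe, by simp only [fracEdges, Finset.mem_filter, Finset.mem_univ, true_and]; exact hf⟩

/-- **THE EDGE-INDUCTION SCHEMA.**  If for every weight function `w` and every edge `e` both mixed Bernstein coefficients of `E₃(A,B,C)` along `e`
are nonnegative, then `E₃(A,B,C) ≥ 0` under `prodBernoulli w` for every `w`. [this work] -/
theorem sahiE3_nonneg_of_edgeBernstein (A B C : Set (BondConfig (Fin n)))
    (h : ∀ (w : Sym2 (Fin n) → unitInterval) (e : Sym2 (Fin n)),
      0 ≤ polar₁ (prodBernoulli (Function.update w e 0)) (prodBernoulli (Function.update w e 1)) A B C ∧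
        0 ≤ polar₁ (prodBernoulli (Function.update w e 1)) (prodBernoulli (Function.update w e 0)) A B C) :
    ∀ w : Sym2 (Fin n) → unitInterval, 0 ≤ sahiE3 (prodBernoulli w) A B C := by
  -- induction on the number of fractional edges
  suffices H : ∀ (k : ℕ) (w : Sym2 (Fin n) → unitInterval), (fracEdges w).card ≤ k → 0 ≤ sahiE3 (prodBernoulli w) A B C from
    fun w => H _ w le_rfl
  intro k
  induction k with
  | zero =>
      intro w hk
      have hw : ∀ e, w e = 0 ∨ w e = 1 := fun e =>
        eq_zero_or_one_of_not_mem_fracEdges (by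
          intro he
          have : 0 < (fracEdges w).card := Finset.card_pos.2 ⟨e, he⟩
          omega)
      rw [sahiE3_eq_zero_of_zeroOne w hw]
  | succ k ih =>
      intro w hk
      by_cases hempty : fracEdges w = ∅
      · have hw : ∀ e, w e = 0 ∨ w e = 1 := fun e => eq_zero_or_one_of_not_mem_fracEdges (by rw [hempty]; simp)
        rw [sahiE3_eq_zero_of_zeroOne w hw]
      · obtain ⟨e, he⟩ := Finset.nonempty_iff_ne_empty.2 hempty
        have hcard0 : (fracEdges (Function.update w e 0)).card ≤ k := by
          have h1 := Finset.card_le_card (fracEdges_update_subset w e 0 (Or.inl rfl))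
          rw [Finset.card_erase_of_mem he] at h1
          omega
        have hcard1 : (fracEdges (Function.update w e 1)).card ≤ k := by
          have h1 := Finset.card_le_card (fracEdges_update_subset w e 1 (Or.inr rfl))
          rw [Finset.card_erase_of_mem he] at h1
          omega
        have i0 := ih _ hcard0
        have i1 := ih _ hcard1
        obtain ⟨b1, b2⟩ := h w e
        have hp0 : (0 : ℝ) ≤ w e := (w e).2.1
        have hp1 : (w e : ℝ) ≤ 1 := (w e).2.2
        rw [sahiE3_oneBond w e A B C]
        have hq : (0 : ℝ) ≤ 1 - w e := sub_nonneg.2 hp1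
        positivity

end EdgeInduction

end Summit.CriticalPhenomena.PercolationContinuityZ3.Theorems
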